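import Literature.Analysis.FluidPDE.KochTataruKernel
import Literature.Analysis.FluidPDE.KNSSRemark61
import Literature.Analysis.FluidPDE.OseenSlice
import HarnessLib

/-!
# The `L^∞ × L⁶` slice bound for the Oseen–Koch–Tataru Duhamel kernel

Analysis/FluidPDE proofs file (theorems only; no definitions, no named facts).

For the kernel `K(τ, z)[a, b]` of `e^{τΔ}P∇·` (`oseenKernel`, Koch–Tataru 2001, (8), with the
pointwise bound (14) `‖K(τ,z)[a,b]‖ ≤ C (τ + ‖z‖²)^{-2} ‖a‖ ‖b‖` in dimension three, tree
`exists_norm_oseenKernel_le`) and a bounded continuous field `f : ℝ³ → ℝ³`, `‖f‖ ≤ A`, which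
differs from a constant vector `c`, `‖c‖ ≤ A`, by an `L⁶` function, the spatial Duhamel slice
obeys

  `‖∫ K(τ, x − y)[f(y), f(y)] dy‖ ≤ C₆ τ^{-3/4} A ‖f − c‖_{L⁶}`      (`C₆` absolute).

Proof: by bilinearity and the ZERO MEAN of the kernel (`∫ K(τ, x − y)[c, c] dy = 0`, tree
`integral_oseenKernel_sub_left_eq_zero`, Koch–Nadirashvili–Seregin–Šverák 2009, Remark 6.1),
`∫ K[f,f] = ∫ K[f − c, f] + ∫ K[c, f − c]`; each term is at most `C A ∫ (τ + ‖x−y‖²)^{-2} ‖f(y) − c‖ dy`,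
and Hölder with exponents `(6/5, 6)` together with the scaling
`‖(τ + ‖·‖²)^{-2}‖_{L^{6/5}(ℝ³)} = M^{5/6} τ^{-3/4}` (`integral_add_norm_sq_rpow_neg`) finishes. This
is the slice estimate behind the `L^∞_t L^∞_x × L^∞_t Ḣ¹_x` smallness (gap) lemma for Type-I
ancient mild solutions with square-integrable gradients (Sobolev `Ḣ¹ ⊂ L⁶` modulo constants
supplies `c`): compare the `L^∞ × L^∞` slice bound `C M₀ τ^{-1/2} A²` of
`ChaeWolf.norm_integral_oseenKernel_le` (Chae–Wolf 2017, proof of Thm. 1.3, Step 1).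

## References

* H. Koch, D. Tataru, *Well-posedness for the Navier–Stokes equations*, Adv. Math. 157 (2001),
  §2 (8) and §3 (14). [KochTataruAdvMath2001]
* G. Koch, N. Nadirashvili, G. Seregin, V. Šverák, Acta Math. 203 (2009) = arXiv:0709.3599, §4
  (4.3)–(4.5) and Remark 6.1. [KochNadirashviliSereginSverak2009]
-/

noncomputable section

open MeasureTheory Set Function Filter Metric Real
open scoped ENNReal NNReal

namespace Literature.Analysis.FluidPDE

namespace OseenSliceLSix

/-- `((τ + ‖z‖²)^{-2})^{6/5} = (τ + ‖z‖²)^{-12/5}`. [folklore] -/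
private theorem rpow_neg_two_rpow (τ : ℝ) (hτ : 0 < τ) (z : EuclideanSpace ℝ (Fin 3)) :
    ((τ + ‖z‖ ^ 2) ^ (-(2 : ℝ))) ^ ((6 : ℝ) / 5) = (τ + ‖z‖ ^ 2) ^ (-(12 / 5 : ℝ)) := by
  rw [← Real.rpow_mul (by positivity)]
  norm_num

/-- **`L^{6/5}` size of the parabolic majorant**:
`∫ ((τ + ‖x − y‖²)^{-2})^{6/5} dy = τ^{-9/10} ∫ (1 + ‖w‖²)^{-12/5} dw` on `ℝ³`. [folklore] -/
private theorem integral_majorant_rpow {τ : ℝ} (hτ : 0 < τ) (x : EuclideanSpace ℝ (Fin 3)) :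
    ∫ y : EuclideanSpace ℝ (Fin 3), ((τ + ‖x - y‖ ^ 2) ^ (-(2 : ℝ))) ^ ((6 : ℝ) / 5) =
      τ ^ (-(9 / 10 : ℝ)) *
        ∫ w : EuclideanSpace ℝ (Fin 3), (1 + ‖w‖ ^ 2) ^ (-(12 / 5 : ℝ)) := by
  simp_rw [rpow_neg_two_rpow τ hτ]
  have hsub : ∫ y : EuclideanSpace ℝ (Fin 3), (τ + ‖x - y‖ ^ 2) ^ (-(12 / 5 : ℝ)) =
      ∫ z : EuclideanSpace ℝ (Fin 3), (τ + ‖z‖ ^ 2) ^ (-(12 / 5 : ℝ)) :=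
    integral_sub_left_eq_self
      (fun z : EuclideanSpace ℝ (Fin 3) => (τ + ‖z‖ ^ 2) ^ (-(12 / 5 : ℝ))) volume x
  rw [hsub, integral_add_norm_sq_rpow_neg hτ (12 / 5 : ℝ), finrank_euclideanSpace_fin]
  norm_num

/-- The majorant `y ↦ (τ + ‖x − y‖²)^{-2}` lies in `L^{6/5}(ℝ³)`. [folklore] -/
private theorem memLp_majorant {τ : ℝ} (hτ : 0 < τ) (x : EuclideanSpace ℝ (Fin 3)) :
    MemLp (fun y : EuclideanSpace ℝ (Fin 3) => (τ + ‖x - y‖ ^ 2) ^ (-(2 : ℝ)))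
      (ENNReal.ofReal (6 / 5)) volume := by
  have hcont : Continuous fun y : EuclideanSpace ℝ (Fin 3) => (τ + ‖x - y‖ ^ 2) ^ (-(2 : ℝ)) := by
    refine Continuous.rpow_const (by fun_prop) fun y => Or.inl ?_
    positivity
  refine (integrable_norm_rpow_iff hcont.aestronglyMeasurable (by norm_num) ENNReal.ofReal_ne_top).1
    ?_
  have h65 : (ENNReal.ofReal (6 / 5)).toReal = 6 / 5 := ENNReal.toReal_ofReal (by norm_num)
  have he : ((Module.finrank ℝ (EuclideanSpace ℝ (Fin 3)) : ℕ) : ℝ) < 2 * (12 / 5 : ℝ) := by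
    rw [finrank_euclideanSpace_fin]; norm_num
  have hint : Integrable (fun y : EuclideanSpace ℝ (Fin 3) => (τ + ‖x - y‖ ^ 2) ^ (-(12 / 5 : ℝ))) :=
    (integrable_add_norm_sq_rpow_neg he hτ).comp_sub_left x
  refine hint.congr (Eventually.of_forall fun y => ?_)
  have h0 : 0 ≤ (τ + ‖x - y‖ ^ 2) ^ (-(2 : ℝ)) := Real.rpow_nonneg (by positivity) _
  show (τ + ‖x - y‖ ^ 2) ^ (-(12 / 5 : ℝ)) =
    ‖(τ + ‖x - y‖ ^ 2) ^ (-(2 : ℝ))‖ ^ (ENNReal.ofReal (6 / 5)).toReal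
  rw [h65, Real.norm_of_nonneg h0, rpow_neg_two_rpow τ hτ]

end OseenSliceLSix

open OseenSliceLSix in
/-- **The `L^∞ × L⁶` slice bound for the Oseen Duhamel kernel on `ℝ³`.** There is an absolute
constant `C₆ > 0` such that for every `τ > 0`, every point `x`, every bounded continuous field
`f : ℝ³ → ℝ³` with `‖f‖ ≤ A` and every constant vector `c` with `‖c‖ ≤ A` for which `f − c ∈ L⁶`,
`‖∫ K(τ, x − y)[f(y), f(y)] dy‖ ≤ C₆ τ^{-3/4} A (∫ ‖f(y) − c‖⁶ dy)^{1/6}`.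
(Bilinearity, the zero mean of `K(τ, x − ·)`, Koch–Tataru's bound (14) and Hölder `(6/5, 6)`.) [cite: KochTataruAdvMath2001, §3 (14); zero mean: KochNadirashviliSereginSverak2009, Remark 6.1] -/
theorem exists_norm_integral_oseenKernel_le_lsix :
    ∃ C₆ : ℝ, 0 < C₆ ∧ ∀ {τ : ℝ}, 0 < τ → ∀ (x : EuclideanSpace ℝ (Fin 3))
      {f : EuclideanSpace ℝ (Fin 3) → EuclideanSpace ℝ (Fin 3)}, Continuous f →
      ∀ {A : ℝ}, (∀ y, ‖f y‖ ≤ A) → ∀ {c : EuclideanSpace ℝ (Fin 3)}, ‖c‖ ≤ A →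
      MemLp (fun y => f y - c) 6 volume →
      ‖∫ y, oseenKernel τ (x - y) (f y) (f y)‖ ≤
        C₆ * τ ^ (-(3 / 4 : ℝ)) * A * (∫ y, ‖f y - c‖ ^ (6 : ℝ)) ^ (1 / 6 : ℝ) := by
  obtain ⟨C, hC, hK⟩ := exists_norm_oseenKernel_le (E := EuclideanSpace ℝ (Fin 3))
  set M₁ : ℝ := ∫ w : EuclideanSpace ℝ (Fin 3), (1 + ‖w‖ ^ 2) ^ (-(12 / 5 : ℝ)) with hM₁
  have hM₁0 : 0 ≤ M₁ := integral_nonneg fun w => Real.rpow_nonneg (by positivity) _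
  refine ⟨2 * C * M₁ ^ (5 / 6 : ℝ) + 1, by positivity, ?_⟩
  intro τ hτ x f hf A hA c hc hg
  have hK' : ∀ z a b : EuclideanSpace ℝ (Fin 3),
      ‖oseenKernel τ z a b‖ ≤ C * (τ + ‖z‖ ^ 2) ^ (-(2 : ℝ)) * ‖a‖ * ‖b‖ := by
    intro z a b
    have h := hK hτ z a b
    have e : (-((((Module.finrank ℝ (EuclideanSpace ℝ (Fin 3)) : ℕ) : ℝ) + 1) / 2)) = -(2 : ℝ) := by
      rw [finrank_euclideanSpace_fin]; norm_num
    rw [e] at h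
    exact h
  have hA0 : 0 ≤ A := (norm_nonneg _).trans (hA 0)
  -- the fluctuation `g = f - c`, bounded by `2A`
  set g : EuclideanSpace ℝ (Fin 3) → EuclideanSpace ℝ (Fin 3) := fun y => f y - c with hgdef
  have hgc : Continuous g := hf.sub continuous_const
  have hgb : ∀ y, ‖g y‖ ≤ 2 * A := fun y =>
    (norm_sub_le _ _).trans (by linarith [hA y, hc])
  have hfg : ∀ y, f y = g y + c := fun y => (sub_add_cancel (f y) c).symm
  -- the parabolic majorant
  set φ : EuclideanSpace ℝ (Fin 3) → ℝ := fun y => (τ + ‖x - y‖ ^ 2) ^ (-(2 : ℝ)) with hφ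
  have hφ0 : ∀ y, 0 ≤ φ y := fun y => Real.rpow_nonneg (by positivity) _
  have hφc : Continuous φ := by
    refine Continuous.rpow_const (by fun_prop) fun y => Or.inl ?_
    positivity
  have he2 : ((Module.finrank ℝ (EuclideanSpace ℝ (Fin 3)) : ℕ) : ℝ) < 2 * 2 := by
    rw [finrank_euclideanSpace_fin]; norm_num
  have hφi : Integrable φ := (integrable_add_norm_sq_rpow_neg he2 hτ).comp_sub_left x
  -- integrability of the three kernel slices
  have hcm : AEStronglyMeasurable (fun _ : EuclideanSpace ℝ (Fin 3) => c) volume :=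
    aestronglyMeasurable_const
  have hIgf : Integrable (fun y => oseenKernel τ (x - y) (g y) (f y)) volume :=
    integrable_oseenKernel_slice_of_bound hτ hgc.aestronglyMeasurable hf.aestronglyMeasurable
      hgb hA x
  have hIcg : Integrable (fun y => oseenKernel τ (x - y) c (g y)) volume :=
    integrable_oseenKernel_slice_of_bound hτ hcm hgc.aestronglyMeasurable (fun _ => hc) hgb x
  have hIcc : Integrable (fun y => oseenKernel τ (x - y) c c) volume :=
    integrable_oseenKernel_slice_of_bound hτ hcm hcm (fun _ => hc) (fun _ => hc) x
  -- bilinearity and the zero mean of the kernel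
  have hsplit : ∫ y, oseenKernel τ (x - y) (f y) (f y) =
      (∫ y, oseenKernel τ (x - y) (g y) (f y)) + ∫ y, oseenKernel τ (x - y) c (g y) := by
    have hpt : ∀ y, oseenKernel τ (x - y) (f y) (f y) =
        oseenKernel τ (x - y) (g y) (f y) + (oseenKernel τ (x - y) c (g y) +
          oseenKernel τ (x - y) c c) := by
      intro y
      rw [← oseenKernel_add_right, ← hfg y, ← oseenKernel_add_left, ← hfg y]
    have hI23 : Integrable (fun y => oseenKernel τ (x - y) c (g y) + oseenKernel τ (x - y) c c)
        volume := hIcg.add hIcc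
    simp_rw [hpt]
    rw [integral_add hIgf hI23, integral_add hIcg hIcc,
      integral_oseenKernel_sub_left_eq_zero, add_zero]
  -- the weighted `L¹` quantity `I = ∫ φ ‖g‖` and the two slice bounds
  set I : ℝ := ∫ y, φ y * ‖g y‖ with hI
  have hIi : Integrable (fun y => φ y * ‖g y‖) volume :=
    hφi.mul_bdd hgc.norm.aestronglyMeasurable
      (Eventually.of_forall fun y => by rw [Real.norm_of_nonneg (norm_nonneg _)]; exact hgb y)
  have hb1 : ‖∫ y, oseenKernel τ (x - y) (g y) (f y)‖ ≤ C * A * I := by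
    have hG : Integrable (fun y => C * A * (φ y * ‖g y‖)) volume := hIi.const_mul _
    refine (norm_integral_le_of_norm_le hG (Eventually.of_forall fun y => ?_)).trans ?_
    · calc ‖oseenKernel τ (x - y) (g y) (f y)‖
          ≤ C * (τ + ‖x - y‖ ^ 2) ^ (-(2 : ℝ)) * ‖g y‖ * ‖f y‖ := hK' _ _ _
        _ ≤ C * (τ + ‖x - y‖ ^ 2) ^ (-(2 : ℝ)) * ‖g y‖ * A := by
            gcongr
            exact hA y
        _ = C * A * (φ y * ‖g y‖) := by simp only [hφ]; ring
    · rw [integral_const_mul]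
  have hb2 : ‖∫ y, oseenKernel τ (x - y) c (g y)‖ ≤ C * A * I := by
    have hG : Integrable (fun y => C * A * (φ y * ‖g y‖)) volume := hIi.const_mul _
    refine (norm_integral_le_of_norm_le hG (Eventually.of_forall fun y => ?_)).trans ?_
    · calc ‖oseenKernel τ (x - y) c (g y)‖
          ≤ C * (τ + ‖x - y‖ ^ 2) ^ (-(2 : ℝ)) * ‖c‖ * ‖g y‖ := hK' _ _ _
        _ ≤ C * (τ + ‖x - y‖ ^ 2) ^ (-(2 : ℝ)) * A * ‖g y‖ := by
            gcongr
        _ = C * A * (φ y * ‖g y‖) := by simp only [hφ]; ring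
    · rw [integral_const_mul]
  -- Hölder `(6/5, 6)` for `I`
  have hpq : (6 / 5 : ℝ).HolderConjugate 6 := ⟨by norm_num, by norm_num, by norm_num⟩
  have h6 : ENNReal.ofReal 6 = (6 : ℝ≥0∞) := by norm_num
  have hgn : MemLp (fun y => ‖g y‖) (ENNReal.ofReal 6) volume := by
    rw [h6]; exact hg.norm
  have hHolder : I ≤ (∫ y, φ y ^ (6 / 5 : ℝ)) ^ (1 / (6 / 5 : ℝ)) *
      (∫ y, ‖g y‖ ^ (6 : ℝ)) ^ (1 / (6 : ℝ)) :=
    integral_mul_le_Lp_mul_Lq_of_nonneg hpq (Eventually.of_forall hφ0)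
      (Eventually.of_forall fun y => norm_nonneg _) (memLp_majorant hτ x) hgn
  have hmaj : (∫ y, φ y ^ (6 / 5 : ℝ)) ^ (1 / (6 / 5 : ℝ)) = τ ^ (-(3 / 4 : ℝ)) * M₁ ^ (5 / 6 : ℝ) := by
    have e1 : (∫ y, φ y ^ (6 / 5 : ℝ)) = τ ^ (-(9 / 10 : ℝ)) * M₁ := by
      simp only [hφ]
      exact integral_majorant_rpow hτ x
    rw [e1, show (1 / (6 / 5 : ℝ)) = (5 / 6 : ℝ) by norm_num,
      Real.mul_rpow (Real.rpow_nonneg hτ.le _) hM₁0, ← Real.rpow_mul hτ.le]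
    norm_num
  set N : ℝ := (∫ y, ‖g y‖ ^ (6 : ℝ)) ^ (1 / 6 : ℝ) with hN
  have hN0 : 0 ≤ N := Real.rpow_nonneg (integral_nonneg fun y => by positivity) _
  have hI_le : I ≤ τ ^ (-(3 / 4 : ℝ)) * M₁ ^ (5 / 6 : ℝ) * N := by
    rw [← hmaj]
    exact hHolder
  -- assemble
  have hτ34 : 0 ≤ τ ^ (-(3 / 4 : ℝ)) := Real.rpow_nonneg hτ.le _
  calc ‖∫ y, oseenKernel τ (x - y) (f y) (f y)‖
      ≤ ‖∫ y, oseenKernel τ (x - y) (g y) (f y)‖ + ‖∫ y, oseenKernel τ (x - y) c (g y)‖ := by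
        rw [hsplit]; exact norm_add_le _ _
    _ ≤ C * A * I + C * A * I := add_le_add hb1 hb2
    _ = 2 * C * A * I := by ring
    _ ≤ 2 * C * A * (τ ^ (-(3 / 4 : ℝ)) * M₁ ^ (5 / 6 : ℝ) * N) := by
        gcongr
    _ = (2 * C * M₁ ^ (5 / 6 : ℝ)) * τ ^ (-(3 / 4 : ℝ)) * A * N := by ring
    _ ≤ (2 * C * M₁ ^ (5 / 6 : ℝ) + 1) * τ ^ (-(3 / 4 : ℝ)) * A * N := by
        have h0 : 0 ≤ τ ^ (-(3 / 4 : ℝ)) * A * N := mul_nonneg (mul_nonneg hτ34 hA0) hN0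
        have e : (2 * C * M₁ ^ (5 / 6 : ℝ) + 1) * τ ^ (-(3 / 4 : ℝ)) * A * N =
            (2 * C * M₁ ^ (5 / 6 : ℝ)) * τ ^ (-(3 / 4 : ℝ)) * A * N + τ ^ (-(3 / 4 : ℝ)) * A * N := by
          ring
        rw [e]
        linarith

end Literature.Analysis.FluidPDE

end
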